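import Summits.HodgeConjecture.CorCM.IrreducibleOddWeightsShadowIdealsKernels
import HarnessLib

/-!
# Shadow ideals, X: ORBITAL SHADOWS — invariant kernels are combinations of orbit indicators, so the pivot-free criterion
# reads `span{A_O u₀ : O ∈ G\(X₁ × X₀)} ∩ span{A_{O'} u₁ : O' ∈ G\(X₁ × X₁)} = 0`, a finite recipe

COR-CM (cell `pub-hodgecm2`, binder seat `b16` gen 63, count-neutral claim SHADOW IDEALS, file S10 — abstract `G`-set level
and CM fields; theorems only, no definition, no named fact, no `sorry`).  NEW as stated, hence under `Summits/`.  HONEST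
FRAMING: finite-dimensional linear algebra about `dim MT(A₀ × A₁)` for two abelian varieties with complex multiplication
(arbitrary CM fields and types) and about mixed Hodge classes on `A₀^a × A₁^b`; `HC_CM` is neither used nor asserted.

File S7 (`IrreducibleOddWeightsShadowIdealsKernels`): additive iff no `G`-invariant kernels `k₀ : X₁ × X₀ → ℚ`,
`k₁ : X₁ × X₁ → ℚ` have `k₀·u₀ = k₁·u₁ ≠ 0`.  An invariant kernel is constant on the `G`-orbits of pairs, hence
`k = Σ_O k(O)·𝟙_O`; so the vectors `k₀·u₀` sweep exactly the span of the ORBITAL SHADOWS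
`(A_O u₀)(x₁) = Σ_{x₀ : (x₁, x₀) ∈ O} u₀(x₀)`, `O` an orbit of `G` on `X₁ × X₀` (indexed below by any of its points `p`):

* §1 `IrrOdd.kernel_eq_sum_div_card_orbit` (`k(q) = Σ_p [q ∈ Gp]·k(p)/|Gp|`), `IrrOdd.sum_kernel_mul_eq_sum_orbital`,
  **`IrrOdd.sum_kernel_mul_mem_span_orbital`** (`k·u ∈ span{A_p u}`), **`IrrOdd.exists_invariant_kernel_of_mem_span_orbital`**
  (conversely, every element of `span{A_p u}` is `k·u` for an invariant `k`: orbit indicators are invariant).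
* §2 **`IrrOdd.typeRank_sigmaType_add_card_eq_iff_span_orbital_inf_eq_bot`** — `rank(Φ₀, Φ₁) + 2 = rank Φ₀ + rank Φ₁ + 1`
  **iff `span{A_p u₀ : p ∈ X₁ × X₀} ∩ span{A_p u₁ : p ∈ X₁ × X₁} = 0` in `ℚ^{X₁}`.**
* §3 CM fields: **`cmFamilyRank_add_card_eq_pair_iff_span_orbital_shadow_inf_eq_bot`** — ANY two CM fields `K_{i₀}`,
  `K_{i₁}`, any types: `Hg(A₀ × A₁) = Hg(A₀) × Hg(A₁)` **iff the orbital shadows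
  `A_{(a₁,a₀)} u₀ (x₁) = Σ_{x₀ : (x₁,x₀) ∈ Aut(ℂ)·(a₁,a₀)} u₀(x₀)` (one for each `Aut(ℂ)`-orbit on `Hom(K_{i₁},ℂ) × Hom(K_{i₀},ℂ)`,
  i.e. for each factor of `K_{i₁} ⊗_ℚ K_{i₀}`: the SIGNATURE of `Φ_{i₀}` in the relative position `O` to `x₁`) and the orbital
  translates `A_{(a₁,a₁')} u₁` of `u₁` (one for each factor of `K_{i₁} ⊗ K_{i₁}`) span subspaces of `ℚ^{Hom(K_{i₁},ℂ)}` meeting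
  in `0`** — the census recipe; unconditional half `cmFamilyRank_add_card_lt_of_span_orbital_shadow_inf_ne_bot`; Hodge side
  `forall_hodgeClassesProductSpan_pair_iff_span_orbital_shadow_inf_eq_bot`.  For a Galois pivot the orbital shadows are the
  Hecke translates of S5; for `K_{i₁} ↪ K_{i₀}` normal they are gen 62's shadow and its Galois translates.

## References

* [Gordon1999HodgeAVSurvey] B. B. Gordon, *A survey of the Hodge conjecture for abelian varieties*, §3 Theorem (proof),
  7.5–7.7, 9.4.3.
* [Serre1977] J.-P. Serre, *Linear Representations of Finite Groups*, GTM 42, §2.2 Prop. 4; §7 Ex. 7.2.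
* [MoonenZarhin1999LowDim] B. Moonen, Yu. Zarhin, Math. Ann. 315 (1999), Thm. (0.1) (a), §3 (3.1).
* [Shimura1998] G. Shimura, *Abelian Varieties with Complex Multiplication and Modular Functions*, §8.1.
-/

set_option autoImplicit false

noncomputable section

open scoped BigOperators Classical

universe u v w

namespace Summit.HodgeConjecture.CorCM

namespace IrrOdd

open Literature.NumberTheory.ComplexMultiplication

variable {G : Type w} [Group G]

/-! ### §1 Invariant kernels are combinations of orbit indicators -/

section Orbital

variable {X₀ : Type v} {X₁ : Type v} [MulAction G X₀] [MulAction G X₁] [Fintype X₀] [Fintype X₁]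

omit [Fintype X₀] [Fintype X₁] in
/-- The orbit of a pair under the diagonal action: `(x₁, x₀) ∈ G·(a₁, a₀) ⟺ ∃ g, g a₁ = x₁ ∧ g a₀ = x₀`. [folklore] -/
theorem mem_orbit_prod_iff (p q : X₁ × X₀) : q ∈ MulAction.orbit G p ↔ ∃ g : G, g • p.1 = q.1 ∧ g • p.2 = q.2 := by
  simp only [MulAction.mem_orbit_iff, Prod.ext_iff, Prod.smul_fst, Prod.smul_snd]

/-- **An invariant kernel is the combination `Σ_p [q ∈ G·p]·k(p)/|G·p|` of orbit indicators.** [cite: Serre1977, §7 Ex. 7.2] -/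
theorem kernel_eq_sum_div_card_orbit (k : X₁ → X₀ → ℚ) (hk : ∀ (g : G) (x₁ : X₁) (x₀ : X₀), k (g • x₁) (g • x₀) = k x₁ x₀)
    (q : X₁ × X₀) :
    k q.1 q.2 = ∑ p : X₁ × X₀, if q ∈ MulAction.orbit G p then
      k p.1 p.2 / ((Finset.univ.filter fun r : X₁ × X₀ => r ∈ MulAction.orbit G p).card : ℚ) else 0 := by
  rw [← Finset.sum_filter]
  have hfil : (Finset.univ.filter fun p : X₁ × X₀ => q ∈ MulAction.orbit G p) =
      Finset.univ.filter fun p : X₁ × X₀ => p ∈ MulAction.orbit G q := by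
    ext p
    simp only [Finset.mem_filter, Finset.mem_univ, true_and]
    exact MulAction.mem_orbit_symm
  rw [hfil]
  have hconst : ∀ p ∈ Finset.univ.filter (fun p : X₁ × X₀ => p ∈ MulAction.orbit G q),
      k p.1 p.2 / ((Finset.univ.filter fun r : X₁ × X₀ => r ∈ MulAction.orbit G p).card : ℚ) =
        k q.1 q.2 / ((Finset.univ.filter fun r : X₁ × X₀ => r ∈ MulAction.orbit G q).card : ℚ) := by
    intro p hp
    obtain ⟨g, rfl⟩ := MulAction.mem_orbit_iff.1 (Finset.mem_filter.1 hp).2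
    simp only [MulAction.orbit_smul, Prod.smul_fst, Prod.smul_snd, hk]
  rw [Finset.sum_congr rfl hconst, Finset.sum_const, nsmul_eq_mul]
  have hne : ((Finset.univ.filter fun r : X₁ × X₀ => r ∈ MulAction.orbit G q).card : ℚ) ≠ 0 := by
    have hq : q ∈ Finset.univ.filter fun r : X₁ × X₀ => r ∈ MulAction.orbit G q :=
      Finset.mem_filter.2 ⟨Finset.mem_univ _, MulAction.mem_orbit_self q⟩
    exact_mod_cast (Finset.card_pos.2 ⟨q, hq⟩).ne'
  field_simp

/-- `k·u = Σ_p (k(p)/|G·p|) · A_p u` with the ORBITAL operators `(A_p u)(x₁) = Σ_{x₀ : (x₁,x₀) ∈ G·p} u(x₀)`.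
[cite: Serre1977, §7 Ex. 7.2] -/
theorem sum_kernel_mul_eq_sum_orbital (k : X₁ → X₀ → ℚ)
    (hk : ∀ (g : G) (x₁ : X₁) (x₀ : X₀), k (g • x₁) (g • x₀) = k x₁ x₀) (u : X₀ → ℚ) :
    (fun x₁ => ∑ x₀, k x₁ x₀ * u x₀) = ∑ p : X₁ × X₀,
      (k p.1 p.2 / ((Finset.univ.filter fun r : X₁ × X₀ => r ∈ MulAction.orbit G p).card : ℚ)) •
        fun x₁ => ∑ x₀ ∈ Finset.univ.filter (fun x₀ => (x₁, x₀) ∈ MulAction.orbit G p), u x₀ := by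
  funext x₁
  rw [Finset.sum_apply]
  simp only [Pi.smul_apply, smul_eq_mul, Finset.sum_filter, Finset.mul_sum]
  rw [Finset.sum_comm]
  refine Finset.sum_congr rfl fun x₀ _ => ?_
  rw [kernel_eq_sum_div_card_orbit k hk (x₁, x₀), Finset.sum_mul]
  refine Finset.sum_congr rfl fun p _ => ?_
  by_cases hmem : (x₁, x₀) ∈ MulAction.orbit G p
  · rw [if_pos hmem, if_pos hmem]
  · rw [if_neg hmem, if_neg hmem, zero_mul, mul_zero]

/-- **`k·u ∈ span{A_p u : p ∈ X₁ × X₀}` for every invariant kernel `k`.** [cite: Serre1977, §7 Ex. 7.2] -/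
theorem sum_kernel_mul_mem_span_orbital (k : X₁ → X₀ → ℚ)
    (hk : ∀ (g : G) (x₁ : X₁) (x₀ : X₀), k (g • x₁) (g • x₀) = k x₁ x₀) (u : X₀ → ℚ) :
    (fun x₁ => ∑ x₀, k x₁ x₀ * u x₀) ∈ Submodule.span ℚ (Set.range fun p : X₁ × X₀ => fun x₁ =>
      ∑ x₀ ∈ Finset.univ.filter (fun x₀ => (x₁, x₀) ∈ MulAction.orbit G p), u x₀) := by
  rw [sum_kernel_mul_eq_sum_orbital k hk u]
  exact Submodule.sum_mem _ fun p _ => Submodule.smul_mem _ _ (Submodule.subset_span ⟨p, rfl⟩)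

omit [Fintype X₁] in
/-- **Conversely every element of `span{A_p u}` is `k·u` for an invariant kernel `k`** (orbit indicators are invariant).
[cite: Serre1977, §7 Ex. 7.2] -/
theorem exists_invariant_kernel_of_mem_span_orbital (u : X₀ → ℚ) {w : X₁ → ℚ}
    (hw : w ∈ Submodule.span ℚ (Set.range fun p : X₁ × X₀ => fun x₁ =>
      ∑ x₀ ∈ Finset.univ.filter (fun x₀ => (x₁, x₀) ∈ MulAction.orbit G p), u x₀)) :
    ∃ k : X₁ → X₀ → ℚ, (∀ (g : G) (x₁ : X₁) (x₀ : X₀), k (g • x₁) (g • x₀) = k x₁ x₀) ∧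
      (fun x₁ => ∑ x₀, k x₁ x₀ * u x₀) = w := by
  induction hw using Submodule.span_induction with
  | mem w hw =>
    obtain ⟨p, rfl⟩ := hw
    refine ⟨fun x₁ x₀ => if (x₁, x₀) ∈ MulAction.orbit G p then 1 else 0, fun g x₁ x₀ => ?_, ?_⟩
    · have hiff : (g • x₁, g • x₀) ∈ MulAction.orbit G p ↔ (x₁, x₀) ∈ MulAction.orbit G p := by
        rw [show (g • x₁, g • x₀) = g • (x₁, x₀) from rfl, ← MulAction.orbit_eq_iff, MulAction.orbit_smul,
          MulAction.orbit_eq_iff]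
      simp only [hiff]
    · funext x₁
      simp only [Finset.sum_filter, ite_mul, one_mul, zero_mul]
  | zero => exact ⟨fun _ _ => 0, fun _ _ _ => rfl, by funext x₁; simp⟩
  | add w w' _ _ hw hw' =>
    obtain ⟨k, hk, rfl⟩ := hw
    obtain ⟨k', hk', rfl⟩ := hw'
    refine ⟨fun x₁ x₀ => k x₁ x₀ + k' x₁ x₀, fun g x₁ x₀ => by simp only [hk, hk'], ?_⟩
    funext x₁
    simp only [Pi.add_apply, add_mul, Finset.sum_add_distrib]
  | smul c w _ hw =>
    obtain ⟨k, hk, rfl⟩ := hw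
    refine ⟨fun x₁ x₀ => c * k x₁ x₀, fun g x₁ x₀ => by simp only [hk], ?_⟩
    funext x₁
    simp only [Pi.smul_apply, smul_eq_mul, Finset.mul_sum, mul_assoc]

end Orbital

/-! ### §2 The orbital criterion -/

section Criterion

variable {I : Type u} {E : I → Type v} [∀ i, MulAction G (E i)] [DecidableEq I] [Fintype I] [∀ i, Fintype (E i)]
  [Nonempty I] [∀ i, Nonempty (E i)]

/-- **THE ORBITAL CRITERION.**  Any two `G`-sets, CM types `Φ_i` for `ρ`, `u_κ = u_1(Φ_{i_κ})`:
`rank(Φ₀, Φ₁) + 2 = rank Φ₀ + rank Φ₁ + 1` (`Hg(A₀ × A₁) = Hg(A₀) × Hg(A₁)`) **iff the orbital shadows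
`A_p u₀ = (x₁ ↦ Σ_{x₀ : (x₁,x₀) ∈ G·p} u₀(x₀))`, `p ∈ E_{i₁} × E_{i₀}`, and the orbital translates `A_{p'} u₁`,
`p' ∈ E_{i₁} × E_{i₁}`, span subspaces of `ℚ^{E_{i₁}}` meeting in `0`.**
[cite: Gordon1999HodgeAVSurvey, §3 Theorem (proof) and 7.5–7.7] [cite: Serre1977, §7 Ex. 7.2] -/
theorem typeRank_sigmaType_add_card_eq_iff_span_orbital_inf_eq_bot {ρ : G} {Φ : ∀ i, Set (E i)}
    (h : ∀ i, IsCMTypeWith ρ (Φ i)) {i₀ i₁ : I} (hI : ∀ j, j = i₀ ∨ j = i₁) (h01 : i₀ ≠ i₁) :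
    typeRank G (sigmaType Φ) + Fintype.card I = (∑ i, typeRank G (Φ i)) + 1 ↔
      Submodule.span ℚ (Set.range fun p : E i₁ × E i₀ => fun x₁ : E i₁ =>
          ∑ x₀ ∈ Finset.univ.filter (fun x₀ => (x₁, x₀) ∈ MulAction.orbit G p), antiVec (Φ i₀) (1 : G) x₀) ⊓
        Submodule.span ℚ (Set.range fun p : E i₁ × E i₁ => fun x₁ : E i₁ =>
          ∑ x ∈ Finset.univ.filter (fun x => (x₁, x) ∈ MulAction.orbit G p), antiVec (Φ i₁) (1 : G) x) = ⊥ := by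
  rw [typeRank_sigmaType_add_card_eq_iff_not_exists_invariant_kernels h hI h01]
  constructor
  · intro hno
    rw [eq_bot_iff]
    intro w hw
    rw [Submodule.mem_bot]
    by_contra hne
    obtain ⟨k₀, hk₀, hk₀w⟩ := exists_invariant_kernel_of_mem_span_orbital (G := G) (antiVec (Φ i₀) (1 : G)) hw.1
    obtain ⟨k₁, hk₁, hk₁w⟩ := exists_invariant_kernel_of_mem_span_orbital (G := G) (antiVec (Φ i₁) (1 : G)) hw.2
    exact hno ⟨k₀, k₁, hk₀, hk₁, hk₀w.trans hk₁w.symm, by rw [hk₀w]; exact hne⟩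
  · rintro hbot ⟨k₀, k₁, hk₀, hk₁, heq, hne⟩
    apply hne
    have hmem := Submodule.mem_inf.2 ⟨sum_kernel_mul_mem_span_orbital (G := G) k₀ hk₀ (antiVec (Φ i₀) (1 : G)),
      heq ▸ sum_kernel_mul_mem_span_orbital (G := G) k₁ hk₁ (antiVec (Φ i₁) (1 : G))⟩
    rw [hbot, Submodule.mem_bot] at hmem
    exact hmem

/-- **Unconditional half**: a non-zero common element of the two orbital spans forces
`rank(Σ) + |I| < Σ_i rank(Φ_i) + 1`. [cite: Gordon1999HodgeAVSurvey, §3 Theorem (proof) and 7.5] -/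
theorem typeRank_sigmaType_add_card_lt_of_span_orbital_inf_ne_bot {ρ : G} {Φ : ∀ i, Set (E i)}
    (h : ∀ i, IsCMTypeWith ρ (Φ i)) {i₀ i₁ : I} (h01 : i₀ ≠ i₁)
    (hne : Submodule.span ℚ (Set.range fun p : E i₁ × E i₀ => fun x₁ : E i₁ =>
          ∑ x₀ ∈ Finset.univ.filter (fun x₀ => (x₁, x₀) ∈ MulAction.orbit G p), antiVec (Φ i₀) (1 : G) x₀) ⊓
        Submodule.span ℚ (Set.range fun p : E i₁ × E i₁ => fun x₁ : E i₁ =>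
          ∑ x ∈ Finset.univ.filter (fun x => (x₁, x) ∈ MulAction.orbit G p), antiVec (Φ i₁) (1 : G) x) ≠ ⊥) :
    typeRank G (sigmaType Φ) + Fintype.card I < (∑ i, typeRank G (Φ i)) + 1 := by
  obtain ⟨w, ⟨hw₀, hw₁⟩, hw⟩ := (Submodule.ne_bot_iff _).1 hne
  obtain ⟨k₀, hk₀, hk₀w⟩ := exists_invariant_kernel_of_mem_span_orbital (G := G) (antiVec (Φ i₀) (1 : G)) hw₀
  obtain ⟨k₁, hk₁, hk₁w⟩ := exists_invariant_kernel_of_mem_span_orbital (G := G) (antiVec (Φ i₁) (1 : G)) hw₁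
  exact typeRank_sigmaType_add_card_lt_of_invariant_kernels h h01 k₀ k₁ hk₀ hk₁ (hk₀w.trans hk₁w.symm)
    (by rw [hk₀w]; exact hw)

end Criterion

end IrrOdd

/-! ### §3 Any two CM fields: orbital shadows -/

section CM

open CategoryTheory CategoryTheory.Limits NumberField Module IntermediateField
open Literature.NumberTheory.ComplexMultiplication
open Literature.AlgebraicGeometry.Motives (AbelianVariety CMType)
open Literature.AlgebraicGeometry.Motives.AbelianVariety
open Literature.AlgebraicGeometry.HodgeTheory
open Literature.AlgebraicGeometry.ComplexMultiplication (IsCMTypeRealisation)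
open Literature.AlgebraicGeometry.Pohlmann1968

variable {I : Type} [Fintype I] {K : I → Type} [∀ i, Field (K i)] [∀ i, NumberField (K i)] [∀ i, IsCMField (K i)]

/-- **THE ORBITAL CRITERION FOR ANY TWO CM FIELDS** (the census recipe).  Two-slot family `{i₀, i₁}`, CM fields `K_{i₀}`,
`K_{i₁}` (unrelated), types `Φ_i`, `u_κ = 2·𝟙_{Φ_{i_κ}} − 1`.  For a pair `p = (a₁, a₀)` of embeddings the ORBITAL SHADOW of
`Φ_{i₀}` is `x₁ ↦ Σ_{x₀ : (x₁,x₀) ∈ Aut(ℂ)·p} u₀(x₀)` (the signature of `Φ_{i₀}` in the relative position — factor of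
`K_{i₁} ⊗ K_{i₀}` — of `p`); likewise the orbital translates of `u₁` (`p' ∈ Hom(K_{i₁},ℂ)²`).  Then
`Hg(A₀ × A₁) = Hg(A₀) × Hg(A₁)` (`cmFamilyRank Φ + 2 = cmTypeRank Φ₀ + cmTypeRank Φ₁ + 1`) **iff the orbital shadows of
`Φ_{i₀}` and the orbital translates of `u₁` span subspaces of `ℚ^{Hom(K_{i₁},ℂ)}` meeting in `0`.**
[cite: Gordon1999HodgeAVSurvey, §3 Theorem (proof), 7.5–7.7 and 9.4.3] [cite: Serre1977, §7 Ex. 7.2] [cite: Shimura1998, §8.1] -/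
theorem cmFamilyRank_add_card_eq_pair_iff_span_orbital_shadow_inf_eq_bot {i₀ i₁ : I} (h01 : i₀ ≠ i₁)
    (hI : ∀ l, l = i₀ ∨ l = i₁) (Φ : ∀ i, CMType (K i)) :
    CMAlgebra.cmFamilyRank Φ + Fintype.card I = (∑ i, cmTypeRank (Φ i)) + 1 ↔
      Submodule.span ℚ (Set.range fun p : (K i₁ →+* ℂ) × (K i₀ →+* ℂ) => fun x₁ : K i₁ →+* ℂ =>
          ∑ x₀ ∈ Finset.univ.filter (fun x₀ : K i₀ →+* ℂ => (x₁, x₀) ∈ MulAction.orbit (ℂ ≃+* ℂ) p),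
            antiVec (Φ i₀).1 (1 : ℂ ≃+* ℂ) x₀) ⊓
        Submodule.span ℚ (Set.range fun p : (K i₁ →+* ℂ) × (K i₁ →+* ℂ) => fun x₁ : K i₁ →+* ℂ =>
          ∑ x ∈ Finset.univ.filter (fun x : K i₁ →+* ℂ => (x₁, x) ∈ MulAction.orbit (ℂ ≃+* ℂ) p),
            antiVec (Φ i₁).1 (1 : ℂ ≃+* ℂ) x) = ⊥ := by
  haveI : Nonempty I := ⟨i₀⟩
  haveI : ∀ i, Nonempty (K i →+* ℂ) := fun i => inferInstance
  exact IrrOdd.typeRank_sigmaType_add_card_eq_iff_span_orbital_inf_eq_bot (G := ℂ ≃+* ℂ) (E := fun i => K i →+* ℂ)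
    (Φ := fun i => (Φ i).1) (fun i => isCMTypeWith_conj (Φ i)) hI h01

/-- **Unconditional half**: a non-zero common element of the two orbital spans forces
`cmFamilyRank Φ + |I| < Σ_i cmTypeRank Φ_i + 1`. [cite: Gordon1999HodgeAVSurvey, §3 Theorem (proof) and 7.5] -/
theorem cmFamilyRank_add_card_lt_of_span_orbital_shadow_inf_ne_bot {i₀ i₁ : I} (h01 : i₀ ≠ i₁)
    (Φ : ∀ i, CMType (K i))
    (hne : Submodule.span ℚ (Set.range fun p : (K i₁ →+* ℂ) × (K i₀ →+* ℂ) => fun x₁ : K i₁ →+* ℂ =>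
          ∑ x₀ ∈ Finset.univ.filter (fun x₀ : K i₀ →+* ℂ => (x₁, x₀) ∈ MulAction.orbit (ℂ ≃+* ℂ) p),
            antiVec (Φ i₀).1 (1 : ℂ ≃+* ℂ) x₀) ⊓
        Submodule.span ℚ (Set.range fun p : (K i₁ →+* ℂ) × (K i₁ →+* ℂ) => fun x₁ : K i₁ →+* ℂ =>
          ∑ x ∈ Finset.univ.filter (fun x : K i₁ →+* ℂ => (x₁, x) ∈ MulAction.orbit (ℂ ≃+* ℂ) p),
            antiVec (Φ i₁).1 (1 : ℂ ≃+* ℂ) x) ≠ ⊥) :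
    CMAlgebra.cmFamilyRank Φ + Fintype.card I < (∑ i, cmTypeRank (Φ i)) + 1 := by
  haveI : Nonempty I := ⟨i₀⟩
  haveI : ∀ i, Nonempty (K i →+* ℂ) := fun i => inferInstance
  exact IrrOdd.typeRank_sigmaType_add_card_lt_of_span_orbital_inf_ne_bot (G := ℂ ≃+* ℂ) (E := fun i => K i →+* ℂ)
    (Φ := fun i => (Φ i).1) (fun i => isCMTypeWith_conj (Φ i)) h01 hne

variable {Φ : ∀ i, CMType (K i)} {A : I → AbelianVariety ℂ} {ιA : ∀ i, 𝓞 (K i) →+* End (A i)}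
  {θ : ∀ i, K i →+* Module.End ℂ (complexBetti (A i).X 1)}

/-- **Realisations: every Hodge class on every `A₀^a × A₁^b` is a sum of products ⟺ the orbital criterion.**
[cite: MoonenZarhin1999LowDim, §3 (3.1)] [cite: Gordon1999HodgeAVSurvey, 7.5–7.7] -/
theorem forall_hodgeClassesProductSpan_pair_iff_span_orbital_shadow_inf_eq_bot {i₀ i₁ : I} (h01 : i₀ ≠ i₁)
    (hI : ∀ l, l = i₀ ∨ l = i₁) (hA : ∀ i, IsCMTypeRealisation (Φ i) (A i) (ιA i) (θ i)) :
    (∀ (N₁ N₂ : ℕ) [NeZero N₁] [NeZero N₂] (π₁ : Fin N₁ → I) (π₂ : Fin N₂ → I), (∀ l₁ l₂, π₁ l₁ ≠ π₂ l₂) →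
        HodgeClassesProductSpan (⨁ fun l => A (π₁ l)) (⨁ fun l => A (π₂ l))) ↔
      Submodule.span ℚ (Set.range fun p : (K i₁ →+* ℂ) × (K i₀ →+* ℂ) => fun x₁ : K i₁ →+* ℂ =>
          ∑ x₀ ∈ Finset.univ.filter (fun x₀ : K i₀ →+* ℂ => (x₁, x₀) ∈ MulAction.orbit (ℂ ≃+* ℂ) p),
            antiVec (Φ i₀).1 (1 : ℂ ≃+* ℂ) x₀) ⊓
        Submodule.span ℚ (Set.range fun p : (K i₁ →+* ℂ) × (K i₁ →+* ℂ) => fun x₁ : K i₁ →+* ℂ =>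
          ∑ x ∈ Finset.univ.filter (fun x : K i₁ →+* ℂ => (x₁, x) ∈ MulAction.orbit (ℂ ≃+* ℂ) p),
            antiVec (Φ i₁).1 (1 : ℂ ≃+* ℂ) x) = ⊥ := by
  haveI : Nonempty I := ⟨i₀⟩
  exact (cmFamilyRank_add_card_eq_iff_forall_hodgeClassesProductSpan hA).symm.trans
    (cmFamilyRank_add_card_eq_pair_iff_span_orbital_shadow_inf_eq_bot h01 hI Φ)

/-- **A non-zero common element of the orbital spans ⟹ a MIXED exceptional Hodge class** on some biproduct with disjoint
slot maps. [cite: MoonenZarhin1999LowDim, Thm. (0.1) (a)] [cite: Gordon1999HodgeAVSurvey, 7.5] -/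
theorem exists_not_hodgeClassesProductSpan_pair_of_span_orbital_shadow_inf_ne_bot {i₀ i₁ : I} (h01 : i₀ ≠ i₁)
    (hA : ∀ i, IsCMTypeRealisation (Φ i) (A i) (ιA i) (θ i))
    (hne : Submodule.span ℚ (Set.range fun p : (K i₁ →+* ℂ) × (K i₀ →+* ℂ) => fun x₁ : K i₁ →+* ℂ =>
          ∑ x₀ ∈ Finset.univ.filter (fun x₀ : K i₀ →+* ℂ => (x₁, x₀) ∈ MulAction.orbit (ℂ ≃+* ℂ) p),
            antiVec (Φ i₀).1 (1 : ℂ ≃+* ℂ) x₀) ⊓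
        Submodule.span ℚ (Set.range fun p : (K i₁ →+* ℂ) × (K i₁ →+* ℂ) => fun x₁ : K i₁ →+* ℂ =>
          ∑ x ∈ Finset.univ.filter (fun x : K i₁ →+* ℂ => (x₁, x) ∈ MulAction.orbit (ℂ ≃+* ℂ) p),
            antiVec (Φ i₁).1 (1 : ℂ ≃+* ℂ) x) ≠ ⊥) :
    ∃ (N₁ N₂ : ℕ) (_ : NeZero N₁) (_ : NeZero N₂) (π₁ : Fin N₁ → I) (π₂ : Fin N₂ → I),
      (∀ l₁ l₂, π₁ l₁ ≠ π₂ l₂) ∧ ¬ HodgeClassesProductSpan (⨁ fun l => A (π₁ l)) (⨁ fun l => A (π₂ l)) := by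
  haveI : Nonempty I := ⟨i₀⟩
  exact exists_not_hodgeClassesProductSpan_of_cmFamilyRank_add_card_ne hA
    (ne_of_lt (cmFamilyRank_add_card_lt_of_span_orbital_shadow_inf_ne_bot h01 Φ hne))

end CM

end Summit.HodgeConjecture.CorCM

end
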